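import Summits.RiemannHypothesis.RiemannHypothesis.Theorems.PfPersistenceProfileDeriv
import HarnessLib

/-!
# PF persistence — the dilation profile is differentiable exactly when its prime-lag part is

Support file for the crux `EvenSectorBarta.EvenOneSignedWindows` (pub-rhpf campaign, THEORY 1:
the Hadamard edge law; mechanism statements only, no claim about RH). Refines
`PfPersistenceProfileDeriv` from windows `a < ½ log 2` to every window:

* `eventually_sum_weilIncrement_weilDilate_eq`: over ANY finite set of integers whose members
  `n ≥ 2` have `log n > 2b`, the prime sum `Σ Λ(n) n^{-1/2} D_{log n}(f_η)` of the dilates of a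
  window function `f` (vanishing at `|x| ≥ b`) is constant near `η = 0`;
* `hasDerivAt_weilDilationProfile_of_primePart`: for a ground state `u` of the window `a`, IF the
  PRIME-LAG PART `η ↦ Σ_{2 ≤ n, log n ≤ 2a} Λ(n) n^{-1/2} D_{log n}(ũ_η)` has a derivative `W` at
  `η = 0`, then the whole profile has derivative `weilSmallWindowVirial a u + W` there — the pole,
  archimedean and mass parts being differentiable for every `L²` window function
  (`PfPersistencePoleDeriv`, `PfPersistenceArchVirial`) and the prime powers with `log n > 2a`
  contributing constants;
* `mul_deriv_weilGroundEnergy_eq_of_primePart` / `ae_mul_deriv_weilGroundEnergy_eq_of_primePart`: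
  the edge law in virial form `a ε'(a) = −(V(u) + W)` under that single hypothesis (at every
  differentiability point of `ε`, resp. at a.e. `a`).

So hypothesis (h-vir) of THEORY-EDGE-3.md is reduced, in the tree, to the differentiability at
`η = 0` of finitely many functions `η ↦ D_{(1+η) log n}(ũ)`, `2 ≤ n ≤ e^{2a}`: interior regularity of
the autocorrelation of the ground state at the prime-power lags inside the window.
-/

set_option linter.dupNamespace false

noncomputable section

open MeasureTheory Set Filter
open scoped Topology

namespace Summit.RiemannHypothesis.RiemannHypothesis.Theorems.PfPersistence

open Literature.NumberTheory.LFunctions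
open Summit.RiemannHypothesis.RiemannHypothesis.Theorems.WeilWindowFlowWindowLipschitz

/-- Local constancy of a prime sum along dilations, over an arbitrary finite index set whose
members `n ≥ 2` have `2b < log n`. [folklore] -/
theorem eventually_sum_weilIncrement_weilDilate_eq {f : ℝ → ℂ} {b : ℝ} (hf : MemLp f 2)
    (hfs : ∀ x, b ≤ |x| → f x = 0) (S : Finset ℕ) (hS : ∀ n ∈ S, 2 ≤ n → 2 * b < Real.log n) :
    ∀ᶠ η : ℝ in 𝓝 0,
      (∑ n ∈ S, (ArithmeticFunction.vonMangoldt n : ℝ) / Real.sqrt n *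
          weilIncrement (weilDilate η f) (Real.log n)) =
        ∑ n ∈ S, (ArithmeticFunction.vonMangoldt n : ℝ) / Real.sqrt n *
          weilIncrement f (Real.log n) := by
  have hev : ∀ᶠ η : ℝ in 𝓝 0, ∀ n ∈ S, 2 ≤ n → 2 * b < (1 + η) * Real.log n := by
    refine (Finset.eventually_all S).2 fun n hn ↦ ?_
    by_cases h2 : 2 ≤ n
    · have hcont : Continuous fun η : ℝ ↦ (1 + η) * Real.log n := by fun_prop
      have h0 : 2 * b < (1 + (0:ℝ)) * Real.log n := by simpa using hS n hn h2
      exact (Filter.Tendsto.eventually_const_lt h0 hcont.continuousAt).mono fun η h _ ↦ h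
    · exact Eventually.of_forall fun η h ↦ absurd h h2
  filter_upwards [hev, Ioi_mem_nhds (show (-1 : ℝ) < 0 by norm_num)] with η hη hη1
  refine Finset.sum_congr rfl fun n hn ↦ ?_
  rw [weilIncrement_weilDilate f hη1]
  rcases Nat.lt_or_ge n 2 with h2 | h2
  · interval_cases n <;> simp
  · rw [stub_localizedCut_weilIncrement_eq_two_mul hf hfs (hη n hn h2).le,
      stub_localizedCut_weilIncrement_eq_two_mul hf hfs (hS n hn h2).le]

/-- The **prime-lag part** of the dilation profile of a window state: the finitely many prime
powers `2 ≤ n` with `log n ≤ 2a` (lags inside the support scale of `ũ ⋆ ũ̃`). -/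
def weilPrimeLagPart (a : ℝ) (u : ℝ → ℂ) (η : ℝ) : ℝ :=
  ∑ n ∈ (weilPrimeIndex (2 * a)).filter (fun n : ℕ ↦ 2 ≤ n ∧ Real.log (n : ℝ) ≤ 2 * a),
    (ArithmeticFunction.vonMangoldt n : ℝ) / Real.sqrt n *
      weilIncrement (weilDilate η (weilTrunc a u)) (Real.log n)

/-- **The profile is differentiable as soon as its prime-lag part is.** For a ground state `u`
of the window `a`: if `weilPrimeLagPart a u` has derivative `W` at `η = 0`, the dilation profile
has derivative `weilSmallWindowVirial a u + W` there. [folklore] -/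
theorem hasDerivAt_weilDilationProfile_of_primePart {a : ℝ} {u : ℝ → ℂ}
    (hu : IsWeilGroundState a u) {W : ℝ} (hW : HasDerivAt (weilPrimeLagPart a u) W 0) :
    HasDerivAt (weilDilationProfile a u) (weilSmallWindowVirial a u + W) 0 := by
  set f := weilTrunc a u with hf_def
  have hvg : IsWeilGroundState a f := isWeilGroundState_weilTrunc hu
  have hf : MemLp f 2 := hvg.memLp
  have hfs : ∀ x, a ≤ |x| → f x = 0 := fun x hx ↦ weilTrunc_eq_zero u hx
  have hE := (stub_groundStateEnergy a _ hvg).1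
  set P : ℕ → Prop := fun n : ℕ ↦ 2 ≤ n ∧ Real.log (n : ℝ) ≤ 2 * a with hP_def
  have hS : ∀ n ∈ (weilPrimeIndex (2 * a)).filter (fun n ↦ ¬P n), 2 ≤ n → 2 * a < Real.log n := by
    intro n hn h2
    have h := (Finset.mem_filter.1 hn).2
    simp only [hP_def, not_and, not_le] at h
    exact h h2
  have hrest : HasDerivAt (fun η : ℝ ↦ ∑ n ∈ (weilPrimeIndex (2 * a)).filter (fun n ↦ ¬P n),
      (ArithmeticFunction.vonMangoldt n : ℝ) / Real.sqrt n *
        weilIncrement (weilDilate η f) (Real.log n)) 0 0 :=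
    (hasDerivAt_const (0 : ℝ) _).congr_of_eventuallyEq
      (eventually_sum_weilIncrement_weilDilate_eq hf hfs _ hS)
  have hP := (differentiableAt_weilPoleForm_weilDilate hf hfs).hasDerivAt
  have hAr := hasDerivAt_archEnergy_weilDilate hf hE
  have hM := hasDerivAt_mass_weilDilate f
  have e : weilDilationProfile a u = fun η ↦ weilPoleForm (weilDilate η f) +
      ((weilPrimeLagPart a u η + ∑ n ∈ (weilPrimeIndex (2 * a)).filter (fun n ↦ ¬P n),
          (ArithmeticFunction.vonMangoldt n : ℝ) / Real.sqrt n *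
            weilIncrement (weilDilate η f) (Real.log n)) +
        ∫ t in Ioi (0 : ℝ), weilArchDensity t * weilIncrement (weilDilate η f) t) -
      weilMarkovConstant (2 * a) * ∫ x, ‖weilDilate η f x‖ ^ 2 := by
    funext η
    simp only [weilDilationProfile, weilClosedForm, weilDirichletEnergy, weilPrimeLagPart, hP_def,
      ← hf_def, Finset.sum_filter_add_sum_filter_not]
  rw [e]
  refine ((hP.add ((hW.add hrest).add hAr)).sub (hM.const_mul _)).congr_deriv ?_
  simp only [weilSmallWindowVirial, hf_def]
  ring

/-- **Edge law in virial form under the prime-lag hypothesis**: `a ε'(a) = −(V(u) + W)` at every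
differentiability point of `ε`. [folklore] -/
theorem mul_deriv_weilGroundEnergy_eq_of_primePart {a : ℝ} {u : ℝ → ℂ}
    (hu : IsWeilGroundState a u) {W : ℝ} (hW : HasDerivAt (weilPrimeLagPart a u) W 0)
    (hd : DifferentiableAt ℝ weilGroundEnergy a) :
    a * deriv weilGroundEnergy a = -(weilSmallWindowVirial a u + W) :=
  mul_deriv_weilGroundEnergy_eq_neg hu hd (hasDerivAt_weilDilationProfile_of_primePart hu hW)

/-- The same at almost every window, with no differentiability hypothesis on `ε`. [folklore] -/
theorem ae_mul_deriv_weilGroundEnergy_eq_of_primePart :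
    ∀ᵐ a : ℝ, 0 < a → ∀ (u : ℝ → ℂ) (W : ℝ), IsWeilGroundState a u →
      HasDerivAt (weilPrimeLagPart a u) W 0 →
        a * deriv weilGroundEnergy a = -(weilSmallWindowVirial a u + W) := by
  filter_upwards [ae_mul_deriv_weilGroundEnergy_eq_neg] with a h ha u W hu hW
  exact h ha u _ hu (hasDerivAt_weilDilationProfile_of_primePart hu hW)

/-- Consistency with the small-window case: for `a < ½ log 2` the prime-lag part is the empty
sum, so `W = 0`. [folklore] -/
theorem weilPrimeLagPart_eq_zero_of_lt {a : ℝ} (ha2 : a < Real.log 2 / 2) (u : ℝ → ℂ) :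
    weilPrimeLagPart a u = fun _ ↦ 0 := by
  funext η
  refine Finset.sum_eq_zero fun n hn ↦ ?_
  obtain ⟨h2, hlog⟩ := (Finset.mem_filter.1 hn).2
  have : Real.log 2 ≤ Real.log n := Real.log_le_log two_pos (by exact_mod_cast h2)
  linarith

end Summit.RiemannHypothesis.RiemannHypothesis.Theorems.PfPersistence

end
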